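import Literature.NumberTheory.Transcendental.KZRulesAssociator
import Literature.NumberTheory.Transcendental.KZKernelConjectureForms
import Summits.KontsevichZagierPeriods.KontsevichZagierPeriods.Statement
import HarnessLib
import HarnessLib.Audit

/-!
# SoloInformed — the localised conjunct BY ITS LITERATURE NAME: `SoloInformedKZLocAt ⟦[π]⟧` is `KZ.PiLocalKernel`

`Theorems/SoloInformedLocSplit.lean` proved, with no hypotheses, the two-conjunct decomposition of
the summit at every formal period `p` of non-zero value,
`KZP ⟺ SoloInformedKZLocAt p ∧ (p is a non-zero-divisor of P)` (`P = FormalRep ⧸ relations`,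
`SoloInformedKZLocAt p` = injectivity of the extension `P[p⁻¹] → ℝ` of `evalP`), and identified the
second conjunct at `p = ⟦[π]⟧` with the Literature library's open statement `KZ.PiCancellation`
(`soloInformed_piCancellation_iff_cancel`).  The FIRST conjunct at `p = ⟦[π]⟧` is ALSO an open
statement the Literature library already names: `KZ.PiLocalKernel`
[`Literature/NumberTheory/Transcendental/KZProduct.lean`: "every formal `ℤ`-combination of integral
representations with value `0` becomes a relation after multiplying by some power of `[π]`"; the
KZ-calculus transcription of Ayoub's Conjecture 7, *Periods and the conjectures of Grothendieck and
Kontsevich–Zagier*, EMS Newsl. 91 (2014), Def. 6 / Conj. 7, with `π` for `2πi`].  This file records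
that identification over the Literature library alone (it imports no `SoloInformed*` module, so that
it elaborates independently of them):

* `soloInformed_toFormalPeriod_piIter` — `⟦([π]·)^[N] c⟧ = ⟦[π]⟧ᴺ·⟦c⟧` in `P`;
* `soloInformed_piLocalKernel_iff_pow_mul_eq_zero` / `…_iff_pow_mul_eq` — `KZ.PiLocalKernel` ⟺
  (`evalP q = 0 ⇒ ∃ N, ⟦[π]⟧ᴺ q = 0`) ⟺ (`evalP x = evalP y ⇒ ∃ n, ⟦[π]⟧ⁿ x = ⟦[π]⟧ⁿ y`), the last
  being VERBATIM the right-hand side of `soloInformed_kzLocAt_iff` at `p = ⟦[π]⟧`;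
* `soloInformed_piLocalKernel_iff_injective_awayLift` — `KZ.PiLocalKernel` ⟺ injectivity of
  `IsLocalization.Away.lift ⟦[π]⟧ _ : P[⟦[π]⟧⁻¹] → ℝ`, which is `SoloInformedKZLocAt ⟦[π]⟧ _` by
  definition (so the anchor `SoloInformedKZLocAt ⟦[π]⟧ _ ↔ KZ.PiLocalKernel` is this lemma read
  backwards);
* `soloInformed_mem_relations_of_piIter_mem` — under `KZ.PiCancellation`, `([π]·)^[N] c ∈ relations ⇒
  c ∈ relations`;
* `soloInformed_kzp_iff_piLocalKernel_and_piCancellation` — **KZP ⟺ `KZ.PiLocalKernel` ∧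
  `KZ.PiCancellation`**, hypothesis-free, both conjuncts being the Literature library's own named open
  statements (the conjunction's equivalence with the KERNEL form `KZKernelConjecture` is the easy
  algebra `piLocalKernel_and_piCancellation_of_kernel` + peeling powers of `[π]`; the passage to the
  summit is `kzKernelConjecture_iff_isRational`).  This is `soloInformed_kzp_iff_locPi_and_piCancellation`
  of `SoloInformedLocSplit.lean` with conjunct (a) renamed; the same conjunction appears summit-side in
  the tree's AyoubSpecialisation material (registry note in
  `Literature/StrongHypotheses/KontsevichZagierPeriods.lean`), which this seat has not read.

References: M. Kontsevich, D. Zagier, *Periods* (2001), §1.2, §4.1 (`P̂ = P[(2πi)⁻¹]`); J. Ayoub,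
EMS Newsl. 91 (2014), Def. 6, Conj. 7, Rem. 8; A. Huber, G. Wüstholz, *Transcendence and linear
relations of 1-periods* (2022), App. A.3–A.4 (the effective-versus-localised seam).
-/

noncomputable section

open Literature.NumberTheory.Transcendental Literature.NumberTheory.Transcendental.KZ

namespace Summit.KontsevichZagierPeriods.KontsevichZagierPeriods.Theorems

/-! ### Iterated multiplication by `[π]`, read in `P` -/

/-- `⟦([π]·)^[N] c⟧ = ⟦[π]⟧ᴺ · ⟦c⟧` in the formal period ring. [folklore] -/
theorem soloInformed_toFormalPeriod_piIter (N : ℕ) (c : FormalRep) :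
    toFormalPeriod ((fun x => of piRep * x)^[N] c) =
      toFormalPeriod (of piRep) ^ N * toFormalPeriod c := by
  induction N with
  | zero => simp
  | succ N ih =>
    rw [Function.iterate_succ_apply', map_mul, ih, pow_succ', mul_assoc]

/-- `([π]·)^[N] c ∈ relations` iff `⟦[π]⟧ᴺ · ⟦c⟧ = 0` in `P`. [folklore] -/
theorem soloInformed_piIter_mem_relations_iff (N : ℕ) (c : FormalRep) :
    (fun x => of piRep * x)^[N] c ∈ relations ↔
      toFormalPeriod (of piRep) ^ N * toFormalPeriod c = 0 := by
  rw [← toFormalPeriod_eq_zero_iff, soloInformed_toFormalPeriod_piIter]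

/-! ### `KZ.PiLocalKernel` in the formal period ring -/

/-- **`KZ.PiLocalKernel` ⟺ every formal period of value `0` is annihilated by a power of `⟦[π]⟧`.**
[Ayoub 2014, Def. 6 / Conj. 7, transcribed; Kontsevich–Zagier 2001, §4.1] -/
theorem soloInformed_piLocalKernel_iff_pow_mul_eq_zero :
    PiLocalKernel ↔
      ∀ q : FormalPeriodRing, evalP q = 0 → ∃ N : ℕ, toFormalPeriod (of piRep) ^ N * q = 0 := by
  constructor
  · intro h q hq
    obtain ⟨c, rfl⟩ := toFormalPeriod_surjective q
    rw [evalP_toFormalPeriod] at hq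
    obtain ⟨N, hN⟩ := h c hq
    exact ⟨N, (soloInformed_piIter_mem_relations_iff N c).1 hN⟩
  · intro h c hc
    obtain ⟨N, hN⟩ := h (toFormalPeriod c) (by rwa [evalP_toFormalPeriod])
    exact ⟨N, (soloInformed_piIter_mem_relations_iff N c).2 hN⟩

/-- **`KZ.PiLocalKernel` ⟺ formal periods with equal values become equal after multiplication by a
power of `⟦[π]⟧`** — verbatim the right-hand side of `soloInformed_kzLocAt_iff`
(`SoloInformedLocSplit.lean`) at `p = ⟦[π]⟧`. [Kontsevich–Zagier 2001, §4.1; Ayoub 2014, Conj. 7] -/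
theorem soloInformed_piLocalKernel_iff_pow_mul_eq :
    PiLocalKernel ↔
      ∀ x y : FormalPeriodRing, evalP x = evalP y →
        ∃ n : ℕ, toFormalPeriod (of piRep) ^ n * x = toFormalPeriod (of piRep) ^ n * y := by
  rw [soloInformed_piLocalKernel_iff_pow_mul_eq_zero]
  constructor
  · intro h x y hxy
    obtain ⟨n, hn⟩ := h (x - y) (by rw [map_sub, hxy, sub_self])
    exact ⟨n, by rwa [mul_sub, sub_eq_zero] at hn⟩
  · intro h q hq
    obtain ⟨n, hn⟩ := h q 0 (by rw [hq, map_zero])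
    exact ⟨n, by rwa [mul_zero] at hn⟩

/-- **`KZ.PiLocalKernel` ⟺ the period conjecture for the LOCALISED ring `P[⟦[π]⟧⁻¹]`**: the
extension of `evalP` to `Localization.Away ⟦[π]⟧ → ℝ` is injective.  The right-hand side is, by
definition, `SoloInformedKZLocAt ⟦[π]⟧ hp` of `SoloInformedLocSplit.lean`; so conjunct (a) of the
hypothesis-free splitting `soloInformed_kzp_iff_locPi_and_piCancellation` is the Literature library's
`KZ.PiLocalKernel`. [Kontsevich–Zagier 2001, §4.1 (`P̂ = P[(2πi)⁻¹]`); Ayoub 2014, Def. 6 / Conj. 7] -/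
theorem soloInformed_piLocalKernel_iff_injective_awayLift
    (hp : evalP (toFormalPeriod (of piRep)) ≠ 0) :
    PiLocalKernel ↔
      Function.Injective
        (IsLocalization.Away.lift (toFormalPeriod (of piRep)) (isUnit_iff_ne_zero.2 hp) :
          Localization.Away (toFormalPeriod (of piRep)) →+* ℝ) := by
  rw [soloInformed_piLocalKernel_iff_pow_mul_eq]
  unfold IsLocalization.Away.lift
  rw [IsLocalization.lift_injective_iff]
  constructor
  · intro h x y
    refine ⟨fun hxy => ?_, fun hxy => ?_⟩
    · obtain ⟨⟨c, n, rfl⟩, hc⟩ :=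
        (IsLocalization.eq_iff_exists (Submonoid.powers (toFormalPeriod (of piRep)))
          (Localization.Away (toFormalPeriod (of piRep)))).1 hxy
      have hc' := congrArg evalP hc
      simp only [map_mul, map_pow] at hc'
      exact mul_left_cancel₀ (pow_ne_zero n hp) hc'
    · obtain ⟨n, hn⟩ := h x y hxy
      exact (IsLocalization.eq_iff_exists (Submonoid.powers (toFormalPeriod (of piRep)))
        (Localization.Away (toFormalPeriod (of piRep)))).2 ⟨⟨_, n, rfl⟩, hn⟩
  · intro h x y hxy
    obtain ⟨⟨c, n, rfl⟩, hc⟩ :=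
      (IsLocalization.eq_iff_exists (Submonoid.powers (toFormalPeriod (of piRep)))
        (Localization.Away (toFormalPeriod (of piRep)))).1 ((h x y).2 hxy)
    exact ⟨n, hc⟩

/-! ### Peeling powers of `[π]` under `KZ.PiCancellation`, and the splitting in Literature names -/

/-- Under `KZ.PiCancellation`, a relation of the form `([π]·)^[N] c` forces `c` to be a relation
(peel one factor `[π]` at a time). [folklore] -/
theorem soloInformed_mem_relations_of_piIter_mem (hcanc : PiCancellation) :
    ∀ (N : ℕ) (c : FormalRep), (fun x => of piRep * x)^[N] c ∈ relations → c ∈ relations := by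
  intro N
  induction N with
  | zero => intro c hc; simpa using hc
  | succ N ih =>
    intro c hc
    rw [Function.iterate_succ_apply'] at hc
    exact ih c (hcanc _ hc)

/-- `KZ.PiLocalKernel ∧ KZ.PiCancellation ⇒` the kernel form `ker eval = relations`. [folklore] -/
theorem soloInformed_kernel_of_piLocalKernel_of_piCancellation (hloc : PiLocalKernel)
    (hcanc : PiCancellation) : KZKernelConjecture := by
  intro c hc
  obtain ⟨N, hN⟩ := hloc c hc
  exact soloInformed_mem_relations_of_piIter_mem hcanc N c hN

/-- **THEOREM (the summit split at `⟦[π]⟧`, in the Literature library's names; no hypotheses).**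
`KontsevichZagierPeriods ⟺ KZ.PiLocalKernel ∧ KZ.PiCancellation`: the Kontsevich–Zagier period
conjecture for the calculus of `KZCalculus.lean` is exactly the conjunction of the period conjecture
for the localised formal period ring `P[⟦[π]⟧⁻¹]` (Kontsevich–Zagier's `P̂`, Ayoub's `𝒫_KZ`) and the
statement that `⟦[π]⟧` is a non-zero-divisor of `P` (the naive form of "effective Nori motives are a
full subcategory of all Nori motives", open: Huber–Wüstholz 2022, App. A.3–A.4).  Forward: the kernel
form gives both (`piLocalKernel_and_piCancellation_of_kernel`, soundness `relations_le_ker_eval_holds`);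
backward: peel the power of `[π]` (`soloInformed_kernel_of_piLocalKernel_of_piCancellation`); the
kernel form is the summit by `kzKernelConjecture_iff_isRational`.
[Kontsevich–Zagier 2001, §1.2, §4.1; Ayoub 2014, Conj. 7; Huber–Wüstholz 2022, App. A.3–A.4] -/
theorem soloInformed_kzp_iff_piLocalKernel_and_piCancellation :
    KontsevichZagierPeriods ↔ PiLocalKernel ∧ PiCancellation := by
  have hS : KontsevichZagierPeriods ↔ KZKernelConjecture :=
    KontsevichZagierPeriods_iff.trans kzKernelConjecture_iff_isRational.symm
  rw [hS]
  exact ⟨fun hker => piLocalKernel_and_piCancellation_of_kernel relations_le_ker_eval_holds hker,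
    fun h => soloInformed_kernel_of_piLocalKernel_of_piCancellation h.1 h.2⟩

/-- Under `KZ.PiLocalKernel` alone (the localised period conjecture, Ayoub's Conjecture 7 for this
calculus), the summit is exactly `KZ.PiCancellation`. [Ayoub 2014, Conj. 7; Huber–Wüstholz 2022, App. A.4] -/
theorem soloInformed_kzp_iff_piCancellation_of_piLocalKernel (hloc : PiLocalKernel) :
    KontsevichZagierPeriods ↔ PiCancellation :=
  ⟨fun h => (soloInformed_kzp_iff_piLocalKernel_and_piCancellation.1 h).2,
    fun hc => soloInformed_kzp_iff_piLocalKernel_and_piCancellation.2 ⟨hloc, hc⟩⟩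

/-- Under `KZ.PiCancellation` alone, the summit is exactly `KZ.PiLocalKernel` — the localised
(`P̂`-) form of the period conjecture. [Kontsevich–Zagier 2001, §4.1; Ayoub 2014, Conj. 7] -/
theorem soloInformed_kzp_iff_piLocalKernel_of_piCancellation (hcanc : PiCancellation) :
    KontsevichZagierPeriods ↔ PiLocalKernel :=
  ⟨fun h => (soloInformed_kzp_iff_piLocalKernel_and_piCancellation.1 h).1,
    fun hl => soloInformed_kzp_iff_piLocalKernel_and_piCancellation.2 ⟨hl, hcanc⟩⟩

end Summit.KontsevichZagierPeriods.KontsevichZagierPeriods.Theorems
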